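import Mathlib
import Literature.Analysis.FluidPDE.Tao2016AveragedNS.RestartedCascadeFlows
import HarnessLib

/-!
# `GappedFrontRobust`, the (step) clause: SHAPE FACTS OF THE EXACT FLOW'S THREE-PIECE ENVELOPE `A⁰`
  (helper for item stmt-NavierStokesRegularity-22114 `GappedFrontRobustV2`, STEP (5) of the K_B₂ assembly)

HONEST FRAMING: elementary real-number bookkeeping; nothing is asserted about any table or flow; nothing here
concerns the Navier–Stokes equations. The exact flow's a priori envelope of the K_B₂ assembly is the explicit
function `A⁰ k = 2 (C_T + r)(1 + q^{−k})` (`k ≤ kb`), `√(2 (2 E⋆ q^{−2kb} + 2))` (`kb < k ≤ kt`),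
`√(2 K₀) r / w(k−1)` (`k > kt`) (`q = 1+ε₀ > 1`, `kb ≤ −1 < 1 ≤ kt`, `w ≥ 1`); `A0_shape` records its values,
its sign, and the three bounds consumed by the row-sum constant (`rowSum_le_gamma`) and the uniform device
(`A0_le_unif`): `A⁰ k ≤ C_A q^{−k}` up to `kb + 2` with `C_A = 4 (C_T + r) + 2 √(E⋆+1) q²`, `A⁰ k ≤ A_mid` from
`kb + 1` on with `A_mid = √(2 (2 E⋆ q^{−2kb} + 2)) + √(2 K₀) r`, and `A⁰ k ≤ √(2K₀) · r/w(k−1)` beyond `kt`.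
-/

noncomputable section

-- the sub-problem namespace `Summit.NavierStokesRegularity.NavierStokesRegularity` repeats the summit name by design (D-0017)
set_option linter.dupNamespace false

namespace Summit.NavierStokesRegularity.NavierStokesRegularity.Theorems

open Set Literature.Analysis.FluidPDE Literature.Analysis.FluidPDE.TaoCascade

namespace GappedFrontRobust

/-- **Shape facts of the three-piece envelope.** See the module docstring. [folklore] -/
theorem A0_shape {ε₀ r C_T Estar K₀' : ℝ} {w : ℤ → ℝ} {kb kt : ℤ} {A₀ : ℤ → ℝ} (hε : 0 < ε₀)
    (hr : 0 < r) (hCT : 0 < C_T) (hE0 : 0 ≤ Estar) (hw1 : ∀ k, 1 ≤ w k)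
    (hkb : kb ≤ -1) (hkt1 : 1 ≤ kt)
    (hA₀def : A₀ = fun k =>
      if k ≤ kb then 2 * ((C_T + r) * (1 + (1 + ε₀) ^ (-(k : ℝ))))
      else if k ≤ kt then Real.sqrt (2 * (2 * Estar * (1 + ε₀) ^ (-(2 : ℝ) * kb) + 2))
      else Real.sqrt (2 * K₀') * r / w (k - 1)) :
    (∀ k, 0 ≤ A₀ k) ∧
    (∀ k : ℤ, k ≤ kb → 2 * ((C_T + r) * (1 + (1 + ε₀) ^ (-(k : ℝ)))) ≤ A₀ k) ∧
    (∀ k : ℤ, kb + 1 ≤ k → k ≤ kt → Real.sqrt (2 * (2 * Estar * (1 + ε₀) ^ (-(2 : ℝ) * kb) + 2)) ≤ A₀ k) ∧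
    (∀ k : ℤ, kt + 1 ≤ k → Real.sqrt (2 * K₀') * r / w (k - 1) ≤ A₀ k) ∧
    (∀ k : ℤ, k ≤ kb + 2 →
      A₀ k ≤ (4 * (C_T + r) + 2 * Real.sqrt (Estar + 1) * (1 + ε₀) ^ (2 : ℝ)) * (1 + ε₀) ^ (-(k : ℝ))) ∧
    (∀ k : ℤ, kb + 1 ≤ k →
      A₀ k ≤ Real.sqrt (2 * (2 * Estar * (1 + ε₀) ^ (-(2 : ℝ) * kb) + 2)) + Real.sqrt (2 * K₀') * r) ∧
    (∀ k : ℤ, kt + 1 ≤ k → A₀ k ≤ Real.sqrt (2 * K₀') * (r / w (k - 1))) := by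
  have hq : 0 < 1 + ε₀ := by linarith
  have hq1' : 1 ≤ 1 + ε₀ := by linarith
  have hw : ∀ k, 0 < w k := fun k => lt_of_lt_of_le one_pos (hw1 k)
  have hCG0 : 0 < C_T + r := by positivity
  obtain ⟨C_A, hCAdef⟩ : ∃ C_A : ℝ, C_A = 4 * (C_T + r) + 2 * Real.sqrt (Estar + 1) * (1 + ε₀) ^ (2 : ℝ) :=
    ⟨_, rfl⟩
  obtain ⟨A_mid, hAmiddef⟩ : ∃ A_mid : ℝ,
      A_mid = Real.sqrt (2 * (2 * Estar * (1 + ε₀) ^ (-(2 : ℝ) * kb) + 2)) + Real.sqrt (2 * K₀') * r :=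
    ⟨_, rfl⟩
  rw [← hCAdef, ← hAmiddef]
  have hA₀lo : ∀ k : ℤ, k ≤ kb → 2 * ((C_T + r) * (1 + (1 + ε₀) ^ (-(k : ℝ)))) ≤ A₀ k := fun k hk => by
    rw [hA₀def]; simp only [hk, if_true]; exact le_rfl
  have hA₀lo' : ∀ k : ℤ, k ≤ kb → A₀ k = 2 * ((C_T + r) * (1 + (1 + ε₀) ^ (-(k : ℝ)))) := fun k hk => by
    rw [hA₀def]; simp only [hk, if_true]
  have hA₀mid' : ∀ k : ℤ, kb + 1 ≤ k → k ≤ kt →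
      A₀ k = Real.sqrt (2 * (2 * Estar * (1 + ε₀) ^ (-(2 : ℝ) * kb) + 2)) := fun k hk hk' => by
    rw [hA₀def]; simp only [show ¬ (k ≤ kb) from not_le.mpr (by linarith only [hk]), if_false, hk', if_true]
  have hA₀hi' : ∀ k : ℤ, kt + 1 ≤ k → A₀ k = Real.sqrt (2 * K₀') * r / w (k - 1) := fun k hk => by
    rw [hA₀def]
    simp only [show ¬ (k ≤ kb) from not_le.mpr (by linarith only [hk, hkb, hkt1]), if_false,
      show ¬ (k ≤ kt) from not_le.mpr (by linarith only [hk])]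
  have hA₀mid : ∀ k : ℤ, kb + 1 ≤ k → k ≤ kt →
      Real.sqrt (2 * (2 * Estar * (1 + ε₀) ^ (-(2 : ℝ) * kb) + 2)) ≤ A₀ k := fun k hk hk' =>
    (hA₀mid' k hk hk').symm.le
  have hA₀hi : ∀ k : ℤ, kt + 1 ≤ k → Real.sqrt (2 * K₀') * r / w (k - 1) ≤ A₀ k := fun k hk =>
    (hA₀hi' k hk).symm.le
  have hA0 : ∀ k, 0 ≤ A₀ k := by
    intro k
    rcases le_or_gt k kb with hk | hk
    · rw [hA₀lo' k hk]; have := Real.rpow_pos_of_pos hq (-(k : ℝ)); positivity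
    rcases le_or_gt k kt with hk' | hk'
    · rw [hA₀mid' k (by linarith only [hk]) hk']; exact Real.sqrt_nonneg _
    · rw [hA₀hi' k (by linarith only [hk'])]; have := hw (k - 1); positivity
  have hA_lo : ∀ k : ℤ, k ≤ kb + 2 → A₀ k ≤ C_A * (1 + ε₀) ^ (-(k : ℝ)) := by
    intro k hk
    have hxk : 0 < (1 + ε₀) ^ (-(k : ℝ)) := Real.rpow_pos_of_pos hq _
    have hsq0 : 0 ≤ 2 * Real.sqrt (Estar + 1) * (1 + ε₀) ^ (2 : ℝ) := by
      have := Real.rpow_pos_of_pos hq (2 : ℝ); positivity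
    rcases le_or_gt k kb with hk' | hk'
    · -- behind: 2 (C_T + r)(1 + q^{-k}) ≤ 4 (C_T + r) q^{-k}
      rw [hA₀lo' k hk']
      have hk0 : (k : ℝ) ≤ -1 := by exact_mod_cast (hk'.trans hkb)
      have h1 : (1 : ℝ) ≤ (1 + ε₀) ^ (-(k : ℝ)) := Real.one_le_rpow hq1' (by linarith only [hk0])
      have h2 : 2 * ((C_T + r) * (1 + (1 + ε₀) ^ (-(k : ℝ)))) ≤ 4 * (C_T + r) * (1 + ε₀) ^ (-(k : ℝ)) := by
        have h5 := mul_le_mul_of_nonneg_left h1 hCG0.le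
        linarith only [h5]
      have h3 : 4 * (C_T + r) * (1 + ε₀) ^ (-(k : ℝ)) ≤ C_A * (1 + ε₀) ^ (-(k : ℝ)) := by
        rw [hCAdef]
        have h5 := mul_nonneg hsq0 hxk.le
        linarith only [h5]
      linarith only [h2, h3]
    · -- the first two block shells: √(2 E₁) ≤ 2 √(E⋆+1) q^{-kb} ≤ 2 √(E⋆+1) q² q^{-k}
      have hkt' : k ≤ kt := by linarith only [hk, hkb, hkt1]
      rw [hA₀mid' k (by linarith only [hk']) hkt']
      have hkb0 : (kb : ℝ) ≤ -1 := by exact_mod_cast hkb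
      have h1 : (1 : ℝ) ≤ (1 + ε₀) ^ (-(2 : ℝ) * kb) := Real.one_le_rpow hq1' (by linarith only [hkb0])
      have hXkb : 0 ≤ (1 + ε₀) ^ (-(kb : ℝ)) := (Real.rpow_pos_of_pos hq _).le
      have hsE : 0 ≤ Real.sqrt (Estar + 1) := Real.sqrt_nonneg _
      have h2 : 2 * (2 * Estar * (1 + ε₀) ^ (-(2 : ℝ) * kb) + 2) ≤
          (2 * Real.sqrt (Estar + 1) * (1 + ε₀) ^ (-(kb : ℝ))) ^ 2 := by
        have hsq : ((1 + ε₀) ^ (-(kb : ℝ))) ^ 2 = (1 + ε₀) ^ (-(2 : ℝ) * kb) := by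
          rw [← Real.rpow_natCast, ← Real.rpow_mul hq.le]; ring_nf
        have hsqE : Real.sqrt (Estar + 1) ^ 2 = Estar + 1 := Real.sq_sqrt (by linarith only [hE0])
        rw [mul_pow, mul_pow, hsqE, hsq]
        linarith only [h1, hE0]
      have h3 : Real.sqrt (2 * (2 * Estar * (1 + ε₀) ^ (-(2 : ℝ) * kb) + 2)) ≤
          2 * Real.sqrt (Estar + 1) * (1 + ε₀) ^ (-(kb : ℝ)) := by
        calc _ ≤ Real.sqrt ((2 * Real.sqrt (Estar + 1) * (1 + ε₀) ^ (-(kb : ℝ))) ^ 2) := Real.sqrt_le_sqrt h2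
          _ = 2 * Real.sqrt (Estar + 1) * (1 + ε₀) ^ (-(kb : ℝ)) :=
              Real.sqrt_sq (mul_nonneg (mul_nonneg (by norm_num) hsE) hXkb)
      have h4 : (1 + ε₀) ^ (-(kb : ℝ)) ≤ (1 + ε₀) ^ (2 : ℝ) * (1 + ε₀) ^ (-(k : ℝ)) := by
        rw [← Real.rpow_add hq]
        exact Real.rpow_le_rpow_of_exponent_le hq1' (by
          have : (k : ℝ) ≤ kb + 2 := by exact_mod_cast hk
          linarith only [this])
      have h5 : 2 * Real.sqrt (Estar + 1) * (1 + ε₀) ^ (-(kb : ℝ)) ≤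
          2 * Real.sqrt (Estar + 1) * (1 + ε₀) ^ (2 : ℝ) * (1 + ε₀) ^ (-(k : ℝ)) := by
        have := mul_le_mul_of_nonneg_left h4 (mul_nonneg (by norm_num : (0:ℝ) ≤ 2) hsE)
        linarith only [this]
      have h6 : 2 * Real.sqrt (Estar + 1) * (1 + ε₀) ^ (2 : ℝ) * (1 + ε₀) ^ (-(k : ℝ)) ≤
          C_A * (1 + ε₀) ^ (-(k : ℝ)) := by
        rw [hCAdef]
        have := mul_nonneg (mul_nonneg (by norm_num : (0:ℝ) ≤ 4) hCG0.le) hxk.le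
        linarith only [this]
      linarith only [h3, h5, h6]
  have hA_mid : ∀ k : ℤ, kb + 1 ≤ k → A₀ k ≤ A_mid := by
    intro k hk
    rcases le_or_gt k kt with hk' | hk'
    · rw [hA₀mid' k hk hk', hAmiddef]; have : 0 ≤ Real.sqrt (2 * K₀') * r := by positivity
      linarith only [this]
    · rw [hA₀hi' k (by linarith only [hk']), hAmiddef]
      have h1 : Real.sqrt (2 * K₀') * r / w (k - 1) ≤ Real.sqrt (2 * K₀') * r :=
        div_le_self (by positivity) (hw1 _)
      have : 0 ≤ Real.sqrt (2 * (2 * Estar * (1 + ε₀) ^ (-(2 : ℝ) * kb) + 2)) := Real.sqrt_nonneg _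
      linarith only [h1, this]
  have hA_hi : ∀ k : ℤ, kt + 1 ≤ k → A₀ k ≤ Real.sqrt (2 * K₀') * (r / w (k - 1)) := fun k hk => by
    rw [hA₀hi' k hk, mul_div_assoc]
  exact ⟨hA0, hA₀lo, hA₀mid, hA₀hi, hA_lo, hA_mid, hA_hi⟩

end GappedFrontRobust

end Summit.NavierStokesRegularity.NavierStokesRegularity.Theorems

end
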